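import Summits.HodgeConjecture.CorCM.Model.BlockGysin
import Summits.HodgeConjecture.CorCM.Model.ProdFinTopClass
import Summits.HodgeConjecture.CorCM.Model.Universe2
import Summits.HodgeConjecture.CorCM.StubTree.Qw8GeometricBlocks
import HarnessLib

/-!
# F7 `Fact_gysin` for the second model universe `Model2.universe₂` (twin of row Fg7)

Cell `pub-hodgecm2` (COR-CM), seat model-2 (gen 2).  VERBATIM ADAPTATION of seat b25's row-Fg7 files for the model of record
(`CorCM/Model/ProdFinTopClass.lean` §ProdFin, p233802; `CorCM/Model/Gysin.lean`, `Model.universeOf_fact_gysin`) to the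
iso-complete index type: `PicardCM.Var` ↦ `IsoComplete.Var`, `Model.universeOf` ↦ `Model2.universe₂`; the scheme-level
engine (`Model.exists_blockGysin`, `Model.topClass_step`, `Model.blockTop_step`, b25) is used as is.  Result:
`Model2.universe₂_fact_gysin hHD hI hU h₃ : (universe₂ hHD hI hU h₃).Fact_gysin`, no further hypothesis — the last open
geometric input of road 2 (`Assembly/ModelChain2.lean`).
-/

noncomputable section

open CategoryTheory MonoidalCategory CartesianMonoidalCategory
open Literature.AlgebraicTopology.SingularHomology
open Literature.AlgebraicGeometry.Motives (SchemeOver ComplexPoints IsSmoothProjective bettiCohomology bettiCup CMType)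
open Literature.AlgebraicGeometry.HodgeTheory
open Literature.NumberTheory.Automorphic.PicardCM (BallQuotientUniformisedDatum CMAbelianVarietyRealised
  BallQuotientUniformised ballQuotientUniformisedDatum_of mem_ratAlgebraicClasses_iff)

namespace Summit.HodgeConjecture.CorCM

namespace Model2

open Summit.HodgeConjecture.CorCM.Model

section ProdFin

/-- **Additivity of the dimension over the two blocks** of a concatenated product:
`dim (∏_{k ≤ n+1+m} X_k) = dim (∏_{j ≤ n} X_{castAdd j}) + dim (∏_{i ≤ m} X_{natAdd i})`. -/
theorem dim_prodFin_blocks (hHD : exists_isReal_hodgeModel) (hI : hodgePQ_independent_of_hodgeModel)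
    (hU : BallQuotientUniformisedDatum) (h₃ : CMAbelianVarietyRealised) (n : ℕ) :
    ∀ (m : ℕ) (X : Fin (n + 1 + (m + 1)) → IsoComplete.Var),
      IsoComplete.Var.dim ((universe₂ hHD hI hU h₃).prodFin (n + 1 + m) X) =
        IsoComplete.Var.dim ((universe₂ hHD hI hU h₃).prodFin n fun j => X (Fin.castAdd (m + 1) j)) +
          IsoComplete.Var.dim ((universe₂ hHD hI hU h₃).prodFin m fun i => X (Fin.natAdd (n + 1) i)) := by
  intro m
  induction m with
  | zero => intro X; rfl
  | succ m ih =>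
    intro X
    have h := ih (fun i => X i.castSucc)
    exact (congrArg (· + IsoComplete.Var.dim (X (Fin.last (n + 1 + m + 1)))) h).trans (Nat.add_assoc _ _ _)

/-- **A non-zero top class of `∏_{k ≤ n} X_k` determined by the factor projections**: there is
`c ∈ H^{2 dim}(∏ X_k; ℚ)`, `c ≠ 0`, such that any two morphisms `g, g' : Q ⟶ ∏ X_k` with
`g^* ∘ pr_k^* = g'^* ∘ pr_k^*` for all `k` (all degrees) satisfy `g^* c = g'^* c`. -/
theorem exists_topClass_prodFin (hHD : exists_isReal_hodgeModel) (hI : hodgePQ_independent_of_hodgeModel)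
    (hU : BallQuotientUniformisedDatum) (h₃ : CMAbelianVarietyRealised)
    (pr : (n : ℕ) → (X : Fin (n + 1) → IsoComplete.Var) → (j : Fin (n + 1)) → IsoComplete.Var.Mor hU h₃ ((universe₂ hHD hI hU h₃).prodFin n X) (X j))
    (hpr0 : ∀ (X : Fin (0 + 1) → IsoComplete.Var) (k : ℕ), BettiUniverse.pull (pr 0 X 0) k = LinearMap.id)
    (hprL : ∀ (n : ℕ) (X : Fin (n + 1 + 1) → IsoComplete.Var) (k : ℕ),
      BettiUniverse.pull (pr (n + 1) X (Fin.last (n + 1))) k =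
        BettiUniverse.pull (X := IsoComplete.Var.scheme hU h₃ ((universe₂ hHD hI hU h₃).prodFin (n + 1) X)) (Y := IsoComplete.Var.scheme hU h₃ (X (Fin.last (n + 1))))
          (snd (IsoComplete.Var.scheme hU h₃ ((universe₂ hHD hI hU h₃).prodFin n fun i => X i.castSucc)) (IsoComplete.Var.scheme hU h₃ (X (Fin.last (n + 1))))) k)
    (hprC : ∀ (n : ℕ) (X : Fin (n + 1 + 1) → IsoComplete.Var) (i : Fin (n + 1)) (k : ℕ),
      BettiUniverse.pull (pr (n + 1) X i.castSucc) k =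
        BettiUniverse.pull (X := IsoComplete.Var.scheme hU h₃ ((universe₂ hHD hI hU h₃).prodFin (n + 1) X))
            (Y := IsoComplete.Var.scheme hU h₃ ((universe₂ hHD hI hU h₃).prodFin n fun i => X i.castSucc))
            (fst (IsoComplete.Var.scheme hU h₃ ((universe₂ hHD hI hU h₃).prodFin n fun i => X i.castSucc)) (IsoComplete.Var.scheme hU h₃ (X (Fin.last (n + 1))))) k ∘ₗ
          BettiUniverse.pull (pr n (fun i => X i.castSucc) i) k)
    (n : ℕ) : ∀ (X : Fin (n + 1) → IsoComplete.Var),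
    ∃ c : IsoComplete.Var.Coh hU h₃ ((universe₂ hHD hI hU h₃).prodFin n X) (2 * IsoComplete.Var.dim ((universe₂ hHD hI hU h₃).prodFin n X)), c ≠ 0 ∧
      ∀ (Q : IsoComplete.Var) (g g' : IsoComplete.Var.Mor hU h₃ Q ((universe₂ hHD hI hU h₃).prodFin n X)),
        (∀ (k : Fin (n + 1)) (i : ℕ),
            BettiUniverse.pull g i ∘ₗ BettiUniverse.pull (pr n X k) i =
              BettiUniverse.pull g' i ∘ₗ BettiUniverse.pull (pr n X k) i) →
        BettiUniverse.pull g _ c = BettiUniverse.pull g' _ c := by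
  induction n with
  | zero =>
    intro X
    have h1 : Module.finrank ℚ (IsoComplete.Var.Coh hU h₃ (X 0) (2 * (X 0).dim)) = 1 :=
      finrank_rat_top (IsoComplete.Var.isSmoothProjective hU h₃ (X 0))
    refine ⟨BettiUniverse.lineBasis (IsoComplete.Var.isSmoothProjective hU h₃ (X 0)) _ h1 0,
      (BettiUniverse.lineBasis (IsoComplete.Var.isSmoothProjective hU h₃ (X 0)) _ h1).ne_zero 0, ?_⟩
    intro Q g g' hgg
    have h := LinearMap.congr_fun (hgg 0 (2 * (X 0).dim))
      (BettiUniverse.lineBasis (IsoComplete.Var.isSmoothProjective hU h₃ (X 0)) _ h1 0)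
    have e := LinearMap.congr_fun (hpr0 X (2 * (X 0).dim))
      (BettiUniverse.lineBasis (IsoComplete.Var.isSmoothProjective hU h₃ (X 0)) _ h1 0)
    exact ((congrArg (BettiUniverse.pull g _) e).symm.trans h).trans (congrArg (BettiUniverse.pull g' _) e)
  | succ n ih =>
    intro X
    obtain ⟨c', hc'0, hc'⟩ := ih (fun i => X i.castSucc)
    have hdeg : 2 * IsoComplete.Var.dim ((universe₂ hHD hI hU h₃).prodFin n fun i => X i.castSucc) + 2 * (X (Fin.last (n + 1))).dim =
        2 * IsoComplete.Var.dim ((universe₂ hHD hI hU h₃).prodFin (n + 1) X) := by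
      show _ = 2 * (IsoComplete.Var.dim ((universe₂ hHD hI hU h₃).prodFin n fun i => X i.castSucc) + (X (Fin.last (n + 1))).dim)
      ring
    obtain ⟨c, hc0, hc⟩ := topClass_step (L := IsoComplete.Var.scheme hU h₃ (X (Fin.last (n + 1))))
      (IsoComplete.Var.isSmoothProjective hU h₃ ((universe₂ hHD hI hU h₃).prodFin n fun i => X i.castSucc))
      (IsoComplete.Var.isSmoothProjective hU h₃ (X (Fin.last (n + 1)))) hc'0 hdeg
    refine ⟨c, hc0, fun Q g g' hgg ↦ hc (IsoComplete.Var.scheme hU h₃ Q) g g' ?_ ?_⟩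
    · refine hc' Q _ _ fun k i ↦ ?_
      have h := hgg k.castSucc i
      rw [hprC] at h
      simp only [← LinearMap.comp_assoc] at h
      rw [← BettiUniverse.pull_comp g, ← BettiUniverse.pull_comp g'] at h
      exact h
    · have h := hgg (Fin.last (n + 1)) (2 * (X (Fin.last (n + 1))).dim)
      rw [hprL] at h
      exact h

/-- **The genuine block projections** `π_A : ∏_{k ≤ n+1+m} X_k ⟶ ∏_{j ≤ n} X_{castAdd j}` and
`π_B : ∏_{k ≤ n+1+m} X_k ⟶ ∏_{i ≤ m} X_{natAdd i}` (iterated first projection, resp. built with the universal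
property of the binary product): they satisfy the pull-back compatibilities of the package's `IsBlockPair`, and
`π_A^* c_Y ∪ π_B^* c_{Y'} ≠ 0` for all non-zero top classes `c_Y`, `c_{Y'}` of the two partial products. -/
theorem exists_stdBlockPair (hHD : exists_isReal_hodgeModel) (hI : hodgePQ_independent_of_hodgeModel)
    (hU : BallQuotientUniformisedDatum) (h₃ : CMAbelianVarietyRealised)
    (pr : (n : ℕ) → (X : Fin (n + 1) → IsoComplete.Var) → (j : Fin (n + 1)) → IsoComplete.Var.Mor hU h₃ ((universe₂ hHD hI hU h₃).prodFin n X) (X j))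
    (hpr0 : ∀ (X : Fin (0 + 1) → IsoComplete.Var) (k : ℕ), BettiUniverse.pull (pr 0 X 0) k = LinearMap.id)
    (hprL : ∀ (n : ℕ) (X : Fin (n + 1 + 1) → IsoComplete.Var) (k : ℕ),
      BettiUniverse.pull (pr (n + 1) X (Fin.last (n + 1))) k =
        BettiUniverse.pull (X := IsoComplete.Var.scheme hU h₃ ((universe₂ hHD hI hU h₃).prodFin (n + 1) X)) (Y := IsoComplete.Var.scheme hU h₃ (X (Fin.last (n + 1))))
          (snd (IsoComplete.Var.scheme hU h₃ ((universe₂ hHD hI hU h₃).prodFin n fun i => X i.castSucc)) (IsoComplete.Var.scheme hU h₃ (X (Fin.last (n + 1))))) k)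
    (hprC : ∀ (n : ℕ) (X : Fin (n + 1 + 1) → IsoComplete.Var) (i : Fin (n + 1)) (k : ℕ),
      BettiUniverse.pull (pr (n + 1) X i.castSucc) k =
        BettiUniverse.pull (X := IsoComplete.Var.scheme hU h₃ ((universe₂ hHD hI hU h₃).prodFin (n + 1) X))
            (Y := IsoComplete.Var.scheme hU h₃ ((universe₂ hHD hI hU h₃).prodFin n fun i => X i.castSucc))
            (fst (IsoComplete.Var.scheme hU h₃ ((universe₂ hHD hI hU h₃).prodFin n fun i => X i.castSucc)) (IsoComplete.Var.scheme hU h₃ (X (Fin.last (n + 1))))) k ∘ₗ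
          BettiUniverse.pull (pr n (fun i => X i.castSucc) i) k)
    (n : ℕ) : ∀ (m : ℕ) (X : Fin (n + 1 + (m + 1)) → IsoComplete.Var),
    ∃ (πA : IsoComplete.Var.Mor hU h₃ ((universe₂ hHD hI hU h₃).prodFin (n + 1 + m) X) ((universe₂ hHD hI hU h₃).prodFin n fun j => X (Fin.castAdd (m + 1) j)))
      (πB : IsoComplete.Var.Mor hU h₃ ((universe₂ hHD hI hU h₃).prodFin (n + 1 + m) X) ((universe₂ hHD hI hU h₃).prodFin m fun i => X (Fin.natAdd (n + 1) i))),
      (∀ (j : Fin (n + 1)) (k : ℕ),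
          BettiUniverse.pull πA k ∘ₗ BettiUniverse.pull (pr n (fun j => X (Fin.castAdd (m + 1) j)) j) k =
            BettiUniverse.pull (pr (n + 1 + m) X (Fin.castAdd (m + 1) j)) k) ∧
      (∀ (i : Fin (m + 1)) (k : ℕ),
          BettiUniverse.pull πB k ∘ₗ BettiUniverse.pull (pr m (fun i => X (Fin.natAdd (n + 1) i)) i) k =
            BettiUniverse.pull (pr (n + 1 + m) X (Fin.natAdd (n + 1) i)) k) ∧
      ∀ (t : ℕ) (ht : 2 * IsoComplete.Var.dim ((universe₂ hHD hI hU h₃).prodFin n fun j => X (Fin.castAdd (m + 1) j)) +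
            2 * IsoComplete.Var.dim ((universe₂ hHD hI hU h₃).prodFin m fun i => X (Fin.natAdd (n + 1) i)) = t)
        (cY : IsoComplete.Var.Coh hU h₃ ((universe₂ hHD hI hU h₃).prodFin n fun j => X (Fin.castAdd (m + 1) j))
          (2 * IsoComplete.Var.dim ((universe₂ hHD hI hU h₃).prodFin n fun j => X (Fin.castAdd (m + 1) j))))
        (cY' : IsoComplete.Var.Coh hU h₃ ((universe₂ hHD hI hU h₃).prodFin m fun i => X (Fin.natAdd (n + 1) i))
          (2 * IsoComplete.Var.dim ((universe₂ hHD hI hU h₃).prodFin m fun i => X (Fin.natAdd (n + 1) i)))),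
        cY ≠ 0 → cY' ≠ 0 → bettiCup ht (BettiUniverse.pull πA _ cY) (BettiUniverse.pull πB _ cY') ≠ 0 := by
  intro m
  induction m with
  | zero =>
    intro X
    -- `P = Y × X_last`, `Y' = X_last`: `π_A = fst`, `π_B = snd`
    refine ⟨(fst (IsoComplete.Var.scheme hU h₃ ((universe₂ hHD hI hU h₃).prodFin n fun i => X i.castSucc)) (IsoComplete.Var.scheme hU h₃ (X (Fin.last (n + 1)))) :
        IsoComplete.Var.Mor hU h₃ ((universe₂ hHD hI hU h₃).prodFin (n + 1) X) ((universe₂ hHD hI hU h₃).prodFin n fun i => X i.castSucc)),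
      (snd (IsoComplete.Var.scheme hU h₃ ((universe₂ hHD hI hU h₃).prodFin n fun i => X i.castSucc)) (IsoComplete.Var.scheme hU h₃ (X (Fin.last (n + 1)))) :
        IsoComplete.Var.Mor hU h₃ ((universe₂ hHD hI hU h₃).prodFin (n + 1) X) (X (Fin.last (n + 1)))),
      ?_, ?_, ?_⟩
    · intro j k
      exact (hprC n X j k).symm
    · intro i k
      obtain rfl : i = 0 := Fin.fin_one_eq_zero i
      refine LinearMap.ext fun x => ?_
      have e0 := LinearMap.congr_fun (hpr0 (fun i => X (Fin.natAdd (n + 1) i)) k) x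
      have e := LinearMap.congr_fun (hprL n X k) x
      exact (congrArg (BettiUniverse.pull
        (X := IsoComplete.Var.scheme hU h₃ ((universe₂ hHD hI hU h₃).prodFin (n + 1) X)) (Y := IsoComplete.Var.scheme hU h₃ (X (Fin.last (n + 1))))
        (snd (IsoComplete.Var.scheme hU h₃ ((universe₂ hHD hI hU h₃).prodFin n fun i => X i.castSucc)) (IsoComplete.Var.scheme hU h₃ (X (Fin.last (n + 1))))) k) e0).trans
        e.symm
    · intro t ht cY cY' hcY hcY' h0
      exact cup_pull_fst_pull_snd_top_ne_zero (IsoComplete.Var.isSmoothProjective hU h₃ ((universe₂ hHD hI hU h₃).prodFin n fun i => X i.castSucc))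
        (IsoComplete.Var.isSmoothProjective hU h₃ (X (Fin.last (n + 1))))
        hcY hcY' ((cupProduct_eq_zero_iff_of_eq ht rfl _ _).1 h0)
  | succ m ih =>
    intro X
    -- the shorter concatenated product `P₁ = ∏_{k ≤ n+1+m} X_{castSucc k}` with its block pair
    obtain ⟨πA₁, πB₁, hA₁, hB₁, hT₁⟩ := ih (fun i => X i.castSucc)
    have hP₁ := IsoComplete.Var.isSmoothProjective hU h₃ ((universe₂ hHD hI hU h₃).prodFin (n + 1 + m) fun i : Fin (n + 1 + (m + 1)) => X i.castSucc)
    have hL := IsoComplete.Var.isSmoothProjective hU h₃ (X (Fin.last (n + 1 + m + 1)))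
    have hY'₁ := IsoComplete.Var.isSmoothProjective hU h₃
      ((universe₂ hHD hI hU h₃).prodFin m fun i => (fun i : Fin (n + 1 + (m + 1)) => X i.castSucc) (Fin.natAdd (n + 1) i))
    have hdP₁ : 2 * IsoComplete.Var.dim ((universe₂ hHD hI hU h₃).prodFin n fun j => (fun i : Fin (n + 1 + (m + 1)) => X i.castSucc) (Fin.castAdd (m + 1) j)) +
        2 * IsoComplete.Var.dim ((universe₂ hHD hI hU h₃).prodFin m fun i => (fun i : Fin (n + 1 + (m + 1)) => X i.castSucc) (Fin.natAdd (n + 1) i)) =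
        2 * IsoComplete.Var.dim ((universe₂ hHD hI hU h₃).prodFin (n + 1 + m) fun i : Fin (n + 1 + (m + 1)) => X i.castSucc) := by
      rw [dim_prodFin_blocks hHD hI hU h₃ n m (fun i => X i.castSucc)]
      ring
    refine ⟨(fst (IsoComplete.Var.scheme hU h₃ ((universe₂ hHD hI hU h₃).prodFin (n + 1 + m) fun i : Fin (n + 1 + (m + 1)) => X i.castSucc))
          (IsoComplete.Var.scheme hU h₃ (X (Fin.last (n + 1 + m + 1)))) ≫ πA₁ :
        IsoComplete.Var.Mor hU h₃ ((universe₂ hHD hI hU h₃).prodFin (n + 1 + (m + 1)) X) ((universe₂ hHD hI hU h₃).prodFin n fun j => X (Fin.castAdd (m + 1 + 1) j))),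
      (lift (fst (IsoComplete.Var.scheme hU h₃ ((universe₂ hHD hI hU h₃).prodFin (n + 1 + m) fun i : Fin (n + 1 + (m + 1)) => X i.castSucc))
          (IsoComplete.Var.scheme hU h₃ (X (Fin.last (n + 1 + m + 1)))) ≫ πB₁)
        (snd (IsoComplete.Var.scheme hU h₃ ((universe₂ hHD hI hU h₃).prodFin (n + 1 + m) fun i : Fin (n + 1 + (m + 1)) => X i.castSucc))
          (IsoComplete.Var.scheme hU h₃ (X (Fin.last (n + 1 + m + 1))))) :
        IsoComplete.Var.Mor hU h₃ ((universe₂ hHD hI hU h₃).prodFin (n + 1 + (m + 1)) X) ((universe₂ hHD hI hU h₃).prodFin (m + 1) fun i => X (Fin.natAdd (n + 1) i))),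
      ?_, ?_, ?_⟩
    · -- compatibility of `π_A` with the first-block projections
      intro j k
      refine (pull_comp_comp_eq _ πA₁ _ _ k (hA₁ j k)).trans ?_
      refine Eq.trans ?_ (hprC (n + 1 + m) X (Fin.castAdd (m + 1) j) k).symm
      exact BettiUniverse.pull_comp _ _ k
    · -- compatibility of `π_B` with the second-block projections
      intro i k
      induction i using Fin.lastCases with
      | last =>
        rw [hprL, ← BettiUniverse.pull_comp]
        refine Eq.trans ?_ (hprL (n + 1 + m) X k).symm
        exact congrArg (BettiUniverse.pull · k) (lift_snd _ _)
      | cast i =>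
        rw [hprC, ← LinearMap.comp_assoc, ← BettiUniverse.pull_comp]
        refine Eq.trans ?_ (hprC (n + 1 + m) X (Fin.natAdd (n + 1) i) k).symm
        refine Eq.trans ?_ ((pull_comp_comp_eq _ πB₁ _ _ k (hB₁ i k)).trans (BettiUniverse.pull_comp _ _ k))
        exact congrArg (fun f => BettiUniverse.pull f k ∘ₗ _) (lift_fst _ _)
    · -- the top classes
      intro t ht cY cY' hcY hcY'
      have htY' : 2 * IsoComplete.Var.dim ((universe₂ hHD hI hU h₃).prodFin m fun i => (fun i : Fin (n + 1 + (m + 1)) => X i.castSucc) (Fin.natAdd (n + 1) i)) +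
          2 * (X (Fin.last (n + 1 + m + 1))).dim = 2 * IsoComplete.Var.dim ((universe₂ hHD hI hU h₃).prodFin (m + 1) fun i => X (Fin.natAdd (n + 1) i)) := by
        show _ = 2 * (IsoComplete.Var.dim ((universe₂ hHD hI hU h₃).prodFin m fun i => (fun i : Fin (n + 1 + (m + 1)) => X i.castSucc)
          (Fin.natAdd (n + 1) i)) + (X (Fin.last (n + 1 + m + 1))).dim)
        ring
      have hfam : IsoComplete.Var.dim ((universe₂ hHD hI hU h₃).prodFin n fun j => (fun i : Fin (n + 1 + (m + 1)) => X i.castSucc) (Fin.castAdd (m + 1) j)) =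
          IsoComplete.Var.dim ((universe₂ hHD hI hU h₃).prodFin n fun j => X (Fin.castAdd (m + 1 + 1) j)) := rfl
      have ht' : 2 * IsoComplete.Var.dim ((universe₂ hHD hI hU h₃).prodFin n fun j => (fun i : Fin (n + 1 + (m + 1)) => X i.castSucc) (Fin.castAdd (m + 1) j)) +
          2 * IsoComplete.Var.dim ((universe₂ hHD hI hU h₃).prodFin (m + 1) fun i => X (Fin.natAdd (n + 1) i)) = t := by
        rw [hfam]; exact ht
      exact blockTop_step hP₁ hL hY'₁ πA₁ πB₁ hdP₁ (fun cY c₁ h h' ↦ hT₁ _ hdP₁ cY c₁ h h') htY' ht' cY cY' hcY hcY'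

/-- **Any pair with the `IsBlockPair` compatibilities sees a non-zero top cup product**: if
`p_A^* ∘ pr_j^* = pr_{castAdd j}^*` and `p_B^* ∘ pr_i^* = pr_{natAdd i}^*` in all degrees, then
`p_A^* e ∪ p_B^* ω ≠ 0` for suitable top classes `e`, `ω` of the two partial products (the hypothesis `hne` of
`Model.exists_blockGysin`). -/
theorem blockPair_top_ne_zero (hHD : exists_isReal_hodgeModel) (hI : hodgePQ_independent_of_hodgeModel)
    (hU : BallQuotientUniformisedDatum) (h₃ : CMAbelianVarietyRealised)
    (pr : (n : ℕ) → (X : Fin (n + 1) → IsoComplete.Var) → (j : Fin (n + 1)) → IsoComplete.Var.Mor hU h₃ ((universe₂ hHD hI hU h₃).prodFin n X) (X j))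
    (hpr0 : ∀ (X : Fin (0 + 1) → IsoComplete.Var) (k : ℕ), BettiUniverse.pull (pr 0 X 0) k = LinearMap.id)
    (hprL : ∀ (n : ℕ) (X : Fin (n + 1 + 1) → IsoComplete.Var) (k : ℕ),
      BettiUniverse.pull (pr (n + 1) X (Fin.last (n + 1))) k =
        BettiUniverse.pull (X := IsoComplete.Var.scheme hU h₃ ((universe₂ hHD hI hU h₃).prodFin (n + 1) X)) (Y := IsoComplete.Var.scheme hU h₃ (X (Fin.last (n + 1))))
          (snd (IsoComplete.Var.scheme hU h₃ ((universe₂ hHD hI hU h₃).prodFin n fun i => X i.castSucc)) (IsoComplete.Var.scheme hU h₃ (X (Fin.last (n + 1))))) k)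
    (hprC : ∀ (n : ℕ) (X : Fin (n + 1 + 1) → IsoComplete.Var) (i : Fin (n + 1)) (k : ℕ),
      BettiUniverse.pull (pr (n + 1) X i.castSucc) k =
        BettiUniverse.pull (X := IsoComplete.Var.scheme hU h₃ ((universe₂ hHD hI hU h₃).prodFin (n + 1) X))
            (Y := IsoComplete.Var.scheme hU h₃ ((universe₂ hHD hI hU h₃).prodFin n fun i => X i.castSucc))
            (fst (IsoComplete.Var.scheme hU h₃ ((universe₂ hHD hI hU h₃).prodFin n fun i => X i.castSucc)) (IsoComplete.Var.scheme hU h₃ (X (Fin.last (n + 1))))) k ∘ₗ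
          BettiUniverse.pull (pr n (fun i => X i.castSucc) i) k)
    (n m : ℕ) (X : Fin (n + 1 + (m + 1)) → IsoComplete.Var)
    (pA : IsoComplete.Var.Mor hU h₃ ((universe₂ hHD hI hU h₃).prodFin (n + 1 + m) X) ((universe₂ hHD hI hU h₃).prodFin n fun j => X (Fin.castAdd (m + 1) j)))
    (pB : IsoComplete.Var.Mor hU h₃ ((universe₂ hHD hI hU h₃).prodFin (n + 1 + m) X) ((universe₂ hHD hI hU h₃).prodFin m fun i => X (Fin.natAdd (n + 1) i)))
    (hA : ∀ (j : Fin (n + 1)) (k : ℕ),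
      BettiUniverse.pull pA k ∘ₗ BettiUniverse.pull (pr n (fun j => X (Fin.castAdd (m + 1) j)) j) k =
        BettiUniverse.pull (pr (n + 1 + m) X (Fin.castAdd (m + 1) j)) k)
    (hB : ∀ (i : Fin (m + 1)) (k : ℕ),
      BettiUniverse.pull pB k ∘ₗ BettiUniverse.pull (pr m (fun i => X (Fin.natAdd (n + 1) i)) i) k =
        BettiUniverse.pull (pr (n + 1 + m) X (Fin.natAdd (n + 1) i)) k) :
    ∃ (t : ℕ) (ht : 2 * IsoComplete.Var.dim ((universe₂ hHD hI hU h₃).prodFin n fun j => X (Fin.castAdd (m + 1) j)) +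
        2 * IsoComplete.Var.dim ((universe₂ hHD hI hU h₃).prodFin m fun i => X (Fin.natAdd (n + 1) i)) = t)
      (e : IsoComplete.Var.Coh hU h₃ ((universe₂ hHD hI hU h₃).prodFin n fun j => X (Fin.castAdd (m + 1) j))
        (2 * IsoComplete.Var.dim ((universe₂ hHD hI hU h₃).prodFin n fun j => X (Fin.castAdd (m + 1) j))))
      (ω : IsoComplete.Var.Coh hU h₃ ((universe₂ hHD hI hU h₃).prodFin m fun i => X (Fin.natAdd (n + 1) i))
        (2 * IsoComplete.Var.dim ((universe₂ hHD hI hU h₃).prodFin m fun i => X (Fin.natAdd (n + 1) i)))),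
      bettiCup ht (BettiUniverse.pull pA _ e) (BettiUniverse.pull pB _ ω) ≠ 0 := by
  obtain ⟨cY, hcY0, hcY⟩ :=
    exists_topClass_prodFin hHD hI hU h₃ pr hpr0 hprL hprC n (fun j => X (Fin.castAdd (m + 1) j))
  obtain ⟨cY', hcY'0, hcY'⟩ :=
    exists_topClass_prodFin hHD hI hU h₃ pr hpr0 hprL hprC m (fun i => X (Fin.natAdd (n + 1) i))
  obtain ⟨πA, πB, hπA, hπB, hT⟩ := exists_stdBlockPair hHD hI hU h₃ pr hpr0 hprL hprC n m X
  refine ⟨_, rfl, cY, cY', ?_⟩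
  rw [hcY _ pA πA (fun k i => by rw [hA k i, hπA k i]), hcY' _ pB πB (fun k i => by rw [hB k i, hπB k i])]
  exact hT _ rfl cY cY' hcY0 hcY'0

end ProdFin

section Projections


/-- `prj_0^* = id` for a one-fold product of the model universe (the hypothesis `hpr0` of
`Model.blockPair_top_ne_zero` for `pr := Universe.prj`). -/
theorem pull_prj_zero (hHD : exists_isReal_hodgeModel) (hI : hodgePQ_independent_of_hodgeModel)
    (hU : BallQuotientUniformisedDatum) (h₃ : CMAbelianVarietyRealised) (X : Fin (0 + 1) → IsoComplete.Var) (k : ℕ) :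
    BettiUniverse.pull ((universe₂ hHD hI hU h₃).prj 0 X 0) k = LinearMap.id := by
  have e : (universe₂ hHD hI hU h₃).prj 0 X 0 = 𝟙 (IsoComplete.Var.scheme hU h₃ (X 0)) := by
    show (universe₂ hHD hI hU h₃).prj 0 X (Fin.last 0) = _
    simp only [Universe.prj, Fin.lastCases_last]
    rfl
  exact (congrArg (BettiUniverse.pull · k) e).trans (BettiUniverse.pull_id _ k)

/-- `prj_{last}^* = snd^*` for an `(n+2)`-fold product of the model universe (hypothesis `hprL`; implicit arguments
pinned to `prodFin (n+1) X`). -/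
theorem pull_prj_last (hHD : exists_isReal_hodgeModel) (hI : hodgePQ_independent_of_hodgeModel)
    (hU : BallQuotientUniformisedDatum) (h₃ : CMAbelianVarietyRealised) (n : ℕ) (X : Fin (n + 1 + 1) → IsoComplete.Var) (k : ℕ) :
    BettiUniverse.pull ((universe₂ hHD hI hU h₃).prj (n + 1) X (Fin.last (n + 1))) k =
      BettiUniverse.pull (X := IsoComplete.Var.scheme hU h₃ ((universe₂ hHD hI hU h₃).prodFin (n + 1) X))
        (Y := IsoComplete.Var.scheme hU h₃ (X (Fin.last (n + 1))))
        (snd (IsoComplete.Var.scheme hU h₃ ((universe₂ hHD hI hU h₃).prodFin n fun i => X i.castSucc))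
          (IsoComplete.Var.scheme hU h₃ (X (Fin.last (n + 1))))) k := by
  have e : (universe₂ hHD hI hU h₃).prj (n + 1) X (Fin.last (n + 1)) =
      (snd (IsoComplete.Var.scheme hU h₃ ((universe₂ hHD hI hU h₃).prodFin n fun i => X i.castSucc))
          (IsoComplete.Var.scheme hU h₃ (X (Fin.last (n + 1)))) :
        IsoComplete.Var.Mor hU h₃ ((universe₂ hHD hI hU h₃).prodFin (n + 1) X) (X (Fin.last (n + 1)))) := by
    simp [Universe.prj]
    rfl
  exact congrArg (BettiUniverse.pull · k) e

/-- `prj_{castSucc i}^* = fst^* ∘ prj_i^*` for an `(n+2)`-fold product of the model universe (hypothesis `hprC`;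
implicit arguments pinned to `prodFin (n+1) X`). -/
theorem pull_prj_castSucc (hHD : exists_isReal_hodgeModel) (hI : hodgePQ_independent_of_hodgeModel)
    (hU : BallQuotientUniformisedDatum) (h₃ : CMAbelianVarietyRealised) (n : ℕ) (X : Fin (n + 1 + 1) → IsoComplete.Var) (i : Fin (n + 1)) (k : ℕ) :
    BettiUniverse.pull ((universe₂ hHD hI hU h₃).prj (n + 1) X i.castSucc) k =
      BettiUniverse.pull (X := IsoComplete.Var.scheme hU h₃ ((universe₂ hHD hI hU h₃).prodFin (n + 1) X))
          (Y := IsoComplete.Var.scheme hU h₃ ((universe₂ hHD hI hU h₃).prodFin n fun i => X i.castSucc))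
          (fst (IsoComplete.Var.scheme hU h₃ ((universe₂ hHD hI hU h₃).prodFin n fun i => X i.castSucc))
            (IsoComplete.Var.scheme hU h₃ (X (Fin.last (n + 1))))) k ∘ₗ
        BettiUniverse.pull ((universe₂ hHD hI hU h₃).prj n (fun i => X i.castSucc) i) k := by
  have e : (universe₂ hHD hI hU h₃).prj (n + 1) X i.castSucc =
      (fst (IsoComplete.Var.scheme hU h₃ ((universe₂ hHD hI hU h₃).prodFin n fun i => X i.castSucc))
          (IsoComplete.Var.scheme hU h₃ (X (Fin.last (n + 1)))) :
        IsoComplete.Var.Mor hU h₃ ((universe₂ hHD hI hU h₃).prodFin (n + 1) X)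
          ((universe₂ hHD hI hU h₃).prodFin n fun i => X i.castSucc)) ≫
        (universe₂ hHD hI hU h₃).prj n (fun i => X i.castSucc) i := by
    simp [Universe.prj]
    rfl
  exact (congrArg (BettiUniverse.pull · k) e).trans (BettiUniverse.pull_comp _ _ k)

/-- **Degree transport of the coniveau condition** along the package's `Universe.castCoh` (a cast along a degree
equality): membership of the complexification in `Nʳ` is unchanged. -/
theorem ofRatClass_castCoh_mem_iff (hHD : exists_isReal_hodgeModel) (hI : hodgePQ_independent_of_hodgeModel)
    (hU : BallQuotientUniformisedDatum) (h₃ : CMAbelianVarietyRealised) (X : IsoComplete.Var) {k l : ℕ} (h : k = l) (r : ℕ)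
    (z : (universe₂ hHD hI hU h₃).Coh X k) :
    ofRatClass (ComplexPoints (IsoComplete.Var.scheme hU h₃ X)) l ((universe₂ hHD hI hU h₃).castCoh X h z) ∈
        supportedClasses (IsoComplete.Var.scheme hU h₃ X) l r ↔
      ofRatClass (ComplexPoints (IsoComplete.Var.scheme hU h₃ X)) k z ∈ supportedClasses (IsoComplete.Var.scheme hU h₃ X) k r := by
  subst h
  exact Iff.rfl

end Projections

/-- **Fact F7 `Fact_gysin` holds in the model universe `universe₂ hHD hI hU h₃`** (row Fg7 of the COR-CM binder
table), with no further hypothesis: block Gysin maps `gy k = s₀⁻¹ • (p_A)_!` (`exists_blockGysin`) for every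
block pair, algebraic classes preserved, projection formula with base change. -/
theorem universe₂_fact_gysin (hHD : exists_isReal_hodgeModel) (hI : hodgePQ_independent_of_hodgeModel)
    (hU : BallQuotientUniformisedDatum) (h₃ : CMAbelianVarietyRealised) :
    (universe₂ hHD hI hU h₃).Fact_gysin := by
  intro F n m Ξ pA pB hbp
  obtain ⟨gy, hgy₁, hgy₂⟩ := exists_blockGysin
    (IsoComplete.Var.isSmoothProjective hU h₃ ((universe₂ hHD hI hU h₃).cmProd F Ξ))
    (IsoComplete.Var.isSmoothProjective hU h₃ ((universe₂ hHD hI hU h₃).cmProd F (blkA Ξ)))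
    (IsoComplete.Var.isSmoothProjective hU h₃ ((universe₂ hHD hI hU h₃).cmProd F (blkB Ξ)))
    (dim_prodFin_blocks hHD hI hU h₃ n m fun k => (universe₂ hHD hI hU h₃).cmAV F (Ξ k)) pA pB
    (blockPair_top_ne_zero hHD hI hU h₃ (universe₂ hHD hI hU h₃).prj (pull_prj_zero hHD hI hU h₃)
      (pull_prj_last hHD hI hU h₃) (pull_prj_castSucc hHD hI hU h₃) n m
      (fun k => (universe₂ hHD hI hU h₃).cmAV F (Ξ k)) pA pB hbp.1 hbp.2)
  refine ⟨gy, fun p z hz ↦ ?_, fun k e ω ↦ hgy₂ k e ω⟩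
  exact hgy₁ p _ ((ofRatClass_castCoh_mem_iff hHD hI hU h₃ _ _ (p + IsoComplete.Var.dim ((universe₂ hHD hI hU h₃).cmProd F (blkB Ξ))) z).2
    ((mem_ratAlgebraicClasses_iff _ _ z).1 hz))

/-- `Fact_gysin` for the model of record `picardCMUniverse₂ hHD hI h₁ h₃`. -/
theorem picardCMUniverse₂_fact_gysin (hHD : exists_isReal_hodgeModel) (hI : hodgePQ_independent_of_hodgeModel)
    (h₁ : BallQuotientUniformised) (h₃ : CMAbelianVarietyRealised) :
    (picardCMUniverse₂ hHD hI h₁ h₃).Fact_gysin :=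
  universe₂_fact_gysin hHD hI (ballQuotientUniformisedDatum_of h₁) h₃


end Model2

end Summit.HodgeConjecture.CorCM

end
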